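import Summits.AnomalousDissipation.AnomalousDissipation.Theorems.EnsembleRigidityDefs
import Summits.AnomalousDissipation.AnomalousDissipation.Theorems.EnsembleRigidityGPMeanBoundedFamilyStubLambIdentity
import Summits.AnomalousDissipation.AnomalousDissipation.Theorems.TaylorCertificatesSteadyStatesLoudBoundedStubGpAdmissible
import Summits.AnomalousDissipation.AnomalousDissipation.Theorems.ImpulseGridGridThesisStubAcdcStrainBound
import Literature.Analysis.FluidPDE.StokesTorusProofs
import Literature.Analysis.FluidPDE.NSHopfGalerkinLimit
import Summits.AnomalousDissipation.AnomalousDissipation.Theorems.EnsembleRigidityGPMeanBoundedFamilyStubHeadModes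
import Literature.Analysis.FunctionSpaces.TorusCalculusProofs
import Literature.Analysis.FunctionSpaces.TorusFluidGlueProofs
import Literature.Analysis.FunctionSpaces.TorusFourierModes

/-!
# Stub `stub_headCoefficients` of line `Sketch` (crux stmt-AnomalousDissipation-15509,
  `EnsembleRigidity.GPMeanBoundedFamily`)

The six head coefficients of the symmetric Galerkin system of the Galloway–Proctor force
`f = f_GP = (sin 2πx₂, sin 2πx₀, sin 2πx₁)` (`gpForce`) and its Lamb mode
`g = (sin2πx₁ cos2πx₂, sin2πx₂ cos2πx₀, sin2πx₀ cos2πx₁)` (`lambMode`):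

* `∫⟪(f·∇)f, g⟫ = 2π · 3/4` — from the Lamb identity `(f·∇)f = 2π g` (`stub_lambIdentity`) and
  `∫‖g‖² = 3/4`;
* `∫⟪(g·∇)g, f⟫ = 0` — `(g·∇)g` is a combination of sine modes with frequencies `k ± k'`, `k, k'` on
  the shell `|k|² = 2`, none of which is `± eⱼ` (orthogonality of the characters);
* `∫⟪(g·∇)g, g⟫ = 0` — `b(g, g, g) = 0` for the solenoidal `g`
  (`Torus.integral_inner_convect_self_eq_zero`);
* `∫⟪(f·∇)g + (g·∇)f, g⟫ = 0` — `b(f, g, g) = 0` and `b(g, f, g) = -b(g, g, f) = 0` (antisymmetry of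
  the trilinear form, `Torus.integral_inner_convect_eq_neg`);
* `∫‖f‖² = 3/2`, `∫‖g‖² = 3/4` — orthogonality of the sine Stokes modes, `∫ sin² = ½`.

The computational core is the pairing formula
`∫⟪Im e_k • a, Im e_{k'} • a'⟫ = ½([k = k'] − [k + k' = 0]) ⟪a, a'⟫` (`integral_inner_sinMode`) and the
convection formula `(Im e_k a·∇)(Im e_{k'} a') = π (k'·a) (Im e_{k+k'} + Im e_{k−k'}) a'`
(`convect_sinMode`), summed over finite families of modes.
-/

noncomputable section

-- every `Summit.AnomalousDissipation.AnomalousDissipation.…` name repeats the summit = sub-problem segment (D-0017 layout)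
set_option linter.dupNamespace false

namespace Summit.AnomalousDissipation.AnomalousDissipation.Theorems.EnsembleRigidity.GPMeanBoundedFamily

open MeasureTheory UnitAddTorus
open scoped InnerProductSpace
open Literature.Analysis.FunctionSpaces Literature.Analysis.FluidPDE
open Summit.AnomalousDissipation.AnomalousDissipation.Theorems.EnsembleRigidity

namespace StubHeadCoefficients

/-! ## Pairing and convection of sine Stokes modes -/

/-- **Pairing of two sine Stokes modes**: `∫⟪Im e_k • a, Im e_{k'} • a'⟫ = ½([k = k'] − [k + k' = 0]) ⟪a, a'⟫`
(the Fourier coefficients of `Im e_{k'} • a'` live on `{k', -k'}`; Grafakos 2014, Prop. 3.2.7 (3)).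
[folklore] -/
theorem integral_inner_sinMode (k k' : Fin 3 → ℤ) (a a' : EuclideanSpace ℝ (Fin 3)) :
    ∫ x : UnitAddTorus (Fin 3), ⟪Torus.stokesMode k a false x, Torus.stokesMode k' a' false x⟫_ℝ =
      2⁻¹ * ((if k = k' then ⟪a, a'⟫_ℝ else 0) - (if k + k' = 0 then ⟪a, a'⟫_ℝ else 0)) := by
  rw [Torus.stokesMode_eq_realTrigPoly k a false, Torus.stokesMode_eq_realTrigPoly k' a' false,
    Torus.integral_inner_realTrigPoly_of_integrable_left {k} _
      (Torus.isSmooth_realTrigPoly {k'} _).integrable,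
    Finset.sum_singleton, Torus.mFourierCoeff_realTrigPoly_singleton]
  have key : inner ℂ ((if false then (1 : ℂ) else -Complex.I) • EuclideanSpace.complexify a)
      ((2 : ℂ)⁻¹ • ((if k = k' then
          (fun _ : Fin 3 → ℤ => (if false then (1 : ℂ) else -Complex.I) • EuclideanSpace.complexify a') k'
            else 0) +
        EuclideanSpace.conjVec (if k = -k' then
          (fun _ : Fin 3 → ℤ => (if false then (1 : ℂ) else -Complex.I) • EuclideanSpace.complexify a') k'
            else 0))) =
      ((2⁻¹ * ((if k = k' then ⟪a, a'⟫_ℝ else 0) - (if k + k' = 0 then ⟪a, a'⟫_ℝ else 0)) : ℝ) : ℂ) := by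
    have hI : Complex.I * (Complex.I * ((⟪a, a'⟫_ℝ : ℝ) : ℂ)) = -((⟪a, a'⟫_ℝ : ℝ) : ℂ) := by
      rw [← mul_assoc, Complex.I_mul_I, neg_one_mul]
    simp only [add_eq_zero_iff_eq_neg]
    split_ifs <;>
      simp (config := { failIfUnchanged := false }) [inner_smul_left, inner_smul_right,
        inner_neg_right, EuclideanSpace.conjVec_smul, EuclideanSpace.conjVec_neg,
        EuclideanSpace.conjVec_zero, EuclideanSpace.conjVec_complexify,
        EuclideanSpace.inner_complexify, hI] at *
  rw [key, Complex.ofReal_re]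

/-- **Convection of two sine Stokes modes**:
`((Im e_k • a)·∇)(Im e_{k'} • a') = π (k'·a) (Im e_{k+k'} + Im e_{k−k'}) • a'`
(`∂ⱼ (Im e_{k'} • a') = 2π k'ⱼ Re e_{k'} • a'` and `2 sin θ cos θ' = sin(θ+θ') + sin(θ−θ')`). [folklore] -/
theorem convect_sinMode (k k' : Fin 3 → ℤ) (a a' : EuclideanSpace ℝ (Fin 3))
    (x : UnitAddTorus (Fin 3)) :
    Torus.convect ⇑(Torus.stokesMode k a false) ⇑(Torus.stokesMode k' a' false) x =
      (Real.pi * ⟪Torus.latticeVec k', a⟫_ℝ) •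
        (Torus.stokesMode (k + k') a' false x + Torus.stokesMode (k - k') a' false x :
          EuclideanSpace ℝ (Fin 3)) := by
  rw [Torus.convect, Torus.fderiv_apply_eq_sum_partialDeriv
    (StubLambIdentity.isContDiff_one_stokesMode k' a' false)]
  simp_rw [AcdcStrain.partialDeriv_stokesMode_sin, smul_smul, ← Finset.sum_smul]
  rw [Torus.stokesMode_apply, Torus.stokesMode_apply, Torus.stokesMode_apply]
  simp only [Bool.false_eq_true, if_false, PiLp.smul_apply, smul_eq_mul, ← add_smul, smul_smul]
  congr 1
  rw [← Torus.sum_intCast_mul_eq_inner_latticeVec, Finset.mul_sum, Finset.sum_mul]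
  refine Finset.sum_congr rfl fun j _ => ?_
  rw [sub_eq_add_neg, mFourier_add, mFourier_add, mFourier_neg]
  simp only [Complex.mul_im, Complex.conj_re, Complex.conj_im]
  ring

/-- The convective derivative is linear in the transporting field: finite real combinations. [folklore] -/
theorem convect_sum_smul_left {ι : Type*} (s : Finset ι) (α : ι → ℝ)
    (u : ι → UnitAddTorus (Fin 3) → EuclideanSpace ℝ (Fin 3))
    (v : UnitAddTorus (Fin 3) → EuclideanSpace ℝ (Fin 3)) (x : UnitAddTorus (Fin 3)) :
    Torus.convect (fun y => ∑ i ∈ s, α i • u i y) v x = ∑ i ∈ s, α i • Torus.convect (u i) v x := by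
  unfold Torus.convect
  rw [map_sum]
  exact Finset.sum_congr rfl fun i _ => by rw [map_smul]

/-- **Convection of two finite combinations of sine Stokes modes**, as one combination of sine modes
indexed by `ι × ι' × Bool` (the Boolean selects the frequency `k + k'` resp. `k − k'`). [folklore] -/
theorem convect_sum_sinMode {ι ι' : Type*} [Fintype ι] [Fintype ι'] (α : ι → ℝ)
    (κ : ι → Fin 3 → ℤ) (b : ι → EuclideanSpace ℝ (Fin 3)) (α' : ι' → ℝ) (κ' : ι' → Fin 3 → ℤ)
    (b' : ι' → EuclideanSpace ℝ (Fin 3)) (x : UnitAddTorus (Fin 3)) :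
    Torus.convect (fun y => ∑ i, α i • (Torus.stokesMode (κ i) (b i) false y : EuclideanSpace ℝ (Fin 3)))
        (fun y => ∑ j, α' j • (Torus.stokesMode (κ' j) (b' j) false y : EuclideanSpace ℝ (Fin 3))) x =
      ∑ p : ι × ι' × Bool, (α p.1 * α' p.2.1 * (Real.pi * ⟪Torus.latticeVec (κ' p.2.1), b p.1⟫_ℝ)) •
        (Torus.stokesMode (if p.2.2 then κ p.1 + κ' p.2.1 else κ p.1 - κ' p.2.1) (b' p.2.1) false x :
          EuclideanSpace ℝ (Fin 3)) := by
  rw [Torus.convect_finset_sum_smul Finset.univ α'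
    (fun j => Torus.isSmooth_stokesMode (κ' j) (b' j) false)]
  simp_rw [convect_sum_smul_left, convect_sinMode, Finset.smul_sum, Fintype.sum_prod_type]
  conv_lhs => rw [Finset.sum_comm]
  refine Finset.sum_congr rfl fun i _ => Finset.sum_congr rfl fun j _ => ?_
  rw [Fintype.sum_bool]
  simp only [if_true, Bool.false_eq_true, if_false, smul_add, smul_smul]
  congr 2 <;> ring

/-- **Pairing of two finite combinations of sine Stokes modes**:
`∫⟪Σᵢ αᵢ Im e_{κᵢ} bᵢ, Σⱼ α'ⱼ Im e_{κ'ⱼ} b'ⱼ⟫ = Σᵢ Σⱼ αᵢ α'ⱼ ½([κᵢ = κ'ⱼ] − [κᵢ + κ'ⱼ = 0]) ⟪bᵢ, b'ⱼ⟫`. [folklore] -/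
theorem integral_inner_sum_sinMode {ι ι' : Type*} [Fintype ι] [Fintype ι'] (α : ι → ℝ)
    (κ : ι → Fin 3 → ℤ) (b : ι → EuclideanSpace ℝ (Fin 3)) (α' : ι' → ℝ) (κ' : ι' → Fin 3 → ℤ)
    (b' : ι' → EuclideanSpace ℝ (Fin 3)) :
    ∫ x : UnitAddTorus (Fin 3),
        ⟪∑ i, α i • (Torus.stokesMode (κ i) (b i) false x : EuclideanSpace ℝ (Fin 3)),
          ∑ j, α' j • (Torus.stokesMode (κ' j) (b' j) false x : EuclideanSpace ℝ (Fin 3))⟫_ℝ =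
      ∑ i, ∑ j, α i * α' j *
        (2⁻¹ * ((if κ i = κ' j then ⟪b i, b' j⟫_ℝ else 0) -
          (if κ i + κ' j = 0 then ⟪b i, b' j⟫_ℝ else 0))) := by
  simp_rw [sum_inner, inner_sum, real_inner_smul_left, real_inner_smul_right]
  have hint : ∀ (i : ι) (j : ι'), Integrable (fun x : UnitAddTorus (Fin 3) => α i * (α' j *
      ⟪(Torus.stokesMode (κ i) (b i) false x : EuclideanSpace ℝ (Fin 3)),
        (Torus.stokesMode (κ' j) (b' j) false x : EuclideanSpace ℝ (Fin 3))⟫_ℝ)) volume :=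
    fun i j => Continuous.integrable_unitAddTorus (by fun_prop)
  rw [integral_finsetSum _ fun i _ => integrable_finsetSum _ fun j _ => hint i j]
  refine Finset.sum_congr rfl fun i _ => ?_
  rw [integral_finsetSum _ fun j _ => hint i j]
  refine Finset.sum_congr rfl fun j _ => ?_
  rw [integral_const_mul, integral_const_mul, integral_inner_sinMode]
  ring

/-! ## The two head modes as combinations of sine Stokes modes -/

/-- The frequencies `eⱼ = Pi.single j 1` in vector notation. [folklore] -/
theorem single_eq_vec :
    (Pi.single (0 : Fin 3) (1 : ℤ) : Fin 3 → ℤ) = ![1, 0, 0] ∧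
      (Pi.single (1 : Fin 3) (1 : ℤ) : Fin 3 → ℤ) = ![0, 1, 0] ∧
      (Pi.single (2 : Fin 3) (1 : ℤ) : Fin 3 → ℤ) = ![0, 0, 1] := by
  refine ⟨?_, ?_, ?_⟩ <;> funext i <;> fin_cases i <;> rfl

/-- `f_GP = Σᵢ Im e_{κᵢ} eᵢ` with `κ = (e₂, e₀, e₁)`. [folklore] -/
theorem gpForce_eq_sum :
    gpForce = fun x => ∑ i : Fin 3, (1 : ℝ) •
      (Torus.stokesMode (![![0, 0, 1], ![1, 0, 0], ![0, 1, 0]] i) (EuclideanSpace.single i (1 : ℝ))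
        false x : EuclideanSpace ℝ (Fin 3)) := by
  funext x
  simp only [gpForce, Fin.sum_univ_three, one_smul, single_eq_vec.1, single_eq_vec.2.1,
    single_eq_vec.2.2, Fin.isValue, Matrix.cons_val]

/-- `g = Σⱼ ½ Im e_{κ'ⱼ} b'ⱼ` with the six frequencies `e₁ ± e₂, ±e₀ + e₂, e₀ ± e₁` and amplitudes
`e₀, e₀, e₁, e₁, e₂, e₂`. [folklore] -/
theorem lambMode_eq_sum :
    lambMode = fun x => ∑ j : Fin 6, (1 / 2 : ℝ) •
      (Torus.stokesMode (![![0, 1, 1], ![0, 1, -1], ![1, 0, 1], ![-1, 0, 1], ![1, 1, 0], ![1, -1, 0]] j)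
        (![EuclideanSpace.single 0 1, EuclideanSpace.single 0 1, EuclideanSpace.single 1 1,
            EuclideanSpace.single 1 1, EuclideanSpace.single 2 1, EuclideanSpace.single 2 1] j)
        false x : EuclideanSpace ℝ (Fin 3)) := by
  funext x
  simp only [lambMode, Fin.sum_univ_six, smul_add, Fin.isValue, Matrix.cons_val]

/-! ## The head integrals -/

/-- `∫‖f_GP‖² = 3/2` (three orthogonal sine modes of mass `½`). [folklore] -/
theorem integral_norm_sq_gpForce : ∫ x : UnitAddTorus (Fin 3), ‖gpForce x‖ ^ 2 = 3 / 2 := by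
  simp_rw [← real_inner_self_eq_norm_sq]
  simp only [gpForce_eq_sum]
  rw [integral_inner_sum_sinMode]
  simp [Fin.sum_univ_three, EuclideanSpace.inner_single_left]
  norm_num

/-- `∫‖g‖² = 3/4` (six orthogonal sine modes of mass `½`, times `¼`). [folklore] -/
theorem integral_norm_sq_lambMode : ∫ x : UnitAddTorus (Fin 3), ‖lambMode x‖ ^ 2 = 3 / 4 := by
  simp_rw [← real_inner_self_eq_norm_sq]
  simp only [lambMode_eq_sum]
  rw [integral_inner_sum_sinMode]
  simp [Fin.sum_univ_six]
  norm_num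

/-- `∫⟪(g·∇)g, f_GP⟫ = 0`: the modes of `(g·∇)g` have frequencies `k ± k'` with `k, k'` on the shell
`|k|² = 2`, none equal or opposite to a frequency `eⱼ` of `f_GP`. [folklore] -/
theorem integral_inner_convect_lambMode_lambMode_gpForce :
    ∫ x : UnitAddTorus (Fin 3), ⟪Torus.convect lambMode lambMode x, gpForce x⟫_ℝ = 0 := by
  simp only [gpForce_eq_sum, lambMode_eq_sum, convect_sum_sinMode]
  rw [integral_inner_sum_sinMode]
  simp [Fintype.sum_prod_type, Fin.sum_univ_six, Fin.sum_univ_three,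
    EuclideanSpace.inner_single_right]

end StubHeadCoefficients

open StubHeadCoefficients in
/-- **Stub `stub_headCoefficients` of crux `GPMeanBoundedFamily`, line `Sketch`.** The head
coefficients of the symmetric Galerkin system of the Galloway–Proctor force `f = f_GP` and its Lamb
mode `g`: `∫⟪(f·∇)f, g⟫ = 2π·(3/4)` (Lamb identity `(f·∇)f = 2π g` and `∫‖g‖² = 3/4`),
`∫⟪(g·∇)g, f⟫ = 0` (orthogonality of the characters: `(g·∇)g` carries no frequency `±eⱼ`),
`∫⟪(g·∇)g, g⟫ = 0` and `∫⟪(f·∇)g + (g·∇)f, g⟫ = 0` (antisymmetry of the trilinear form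
`b(u,v,w) = -b(u,w,v)` for solenoidal `u`, Temam 1984, Ch. II §1.2, Lemma 1.3), `∫‖f‖² = 3/2`,
`∫‖g‖² = 3/4` (orthogonality of the sine Stokes modes, `∫ sin² = ½`). [folklore] -/
theorem stub_headCoefficients :
    (∫ x : UnitAddTorus (Fin 3), ⟪Torus.convect gpForce gpForce x, lambMode x⟫_ℝ = 2 * Real.pi * (3 / 4)) ∧
    (∫ x : UnitAddTorus (Fin 3), ⟪Torus.convect lambMode lambMode x, gpForce x⟫_ℝ = 0) ∧
    (∫ x : UnitAddTorus (Fin 3), ⟪Torus.convect lambMode lambMode x, lambMode x⟫_ℝ = 0) ∧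
    (∫ x : UnitAddTorus (Fin 3),
        ⟪Torus.convect gpForce lambMode x + Torus.convect lambMode gpForce x, lambMode x⟫_ℝ = 0) ∧
    (∫ x : UnitAddTorus (Fin 3), ‖gpForce x‖ ^ 2 = 3 / 2) ∧
    (∫ x : UnitAddTorus (Fin 3), ‖lambMode x‖ ^ 2 = 3 / 4) := by
  have hfs : Torus.IsSmooth gpForce := SteadyStatesLoudBounded.GpAdmissible.stub_gpAdmissible.1
  have hfd : Torus.IsDivFree gpForce := SteadyStatesLoudBounded.GpAdmissible.stub_gpAdmissible.2.1
  have hgs : Torus.IsSmooth lambMode := stub_headModes.1.1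
  have hgd : Torus.IsDivFree lambMode := stub_headModes.1.2.1
  have hcomm : ∀ u v : UnitAddTorus (Fin 3) → EuclideanSpace ℝ (Fin 3),
      ∫ x : UnitAddTorus (Fin 3), ⟪u x, v x⟫_ℝ = ∫ x : UnitAddTorus (Fin 3), ⟪v x, u x⟫_ℝ :=
    fun u v => integral_congr_ae (ae_of_all _ fun x => real_inner_comm _ _)
  refine ⟨?_, integral_inner_convect_lambMode_lambMode_gpForce,
    Torus.integral_inner_convect_self_eq_zero hgs hgd, ?_, integral_norm_sq_gpForce,
    integral_norm_sq_lambMode⟩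
  · -- `∫⟪(f·∇)f, g⟫ = 2π ∫‖g‖²`
    simp_rw [stub_lambIdentity, real_inner_smul_left, real_inner_self_eq_norm_sq]
    rw [integral_const_mul, integral_norm_sq_lambMode]
  · -- `b(f,g,g) = 0` and `b(g,f,g) = -b(g,g,f) = 0`
    simp_rw [inner_add_left]
    rw [integral_add ((hfs.convect hgs).inner hgs).integrable ((hgs.convect hfs).inner hgs).integrable]
    have hA : ∫ x : UnitAddTorus (Fin 3), ⟪Torus.convect gpForce lambMode x, lambMode x⟫_ℝ = 0 := by
      have h := Torus.integral_inner_convect_eq_neg hfs hfd hgs hgs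
      rw [hcomm] at h
      rw [hcomm]
      linarith
    have hB : ∫ x : UnitAddTorus (Fin 3), ⟪Torus.convect lambMode gpForce x, lambMode x⟫_ℝ = 0 := by
      rw [Torus.integral_inner_convect_eq_neg hgs hgd hfs hgs, hcomm,
        integral_inner_convect_lambMode_lambMode_gpForce, neg_zero]
    rw [hA, hB, add_zero]

end Summit.AnomalousDissipation.AnomalousDissipation.Theorems.EnsembleRigidity.GPMeanBoundedFamily

end
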